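/-
Copyright (c) 2026 the pub-hodgecm-mathlib formalisation cell (harness21).  Prover seat hodgecm-mathlib-K2Liu-p09 (g6): Track B «K2-LIT»,
hLiu418 = stmt-HodgeConjecture-24832; LEAD F0P6-plan RULING M-158d «A7-val road (σ)», file V8c (the (A4″-KR) assembly: value = constant × small section).
-/
import Summits.HodgeConjecture.HodgeConjecture.Theorems.K2LiuA7ValueLaws              -- ★ V8b p860001 (laws of `ℳ ∘ 𝒜` and `B`; brings ★ V8a, ★ V1, ★ V1d)
import Summits.HodgeConjecture.HodgeConjecture.Theorems.K2LiuNullConeMultiplicityOne  -- ★ V5 `exists_forall_apply_eq_const_mul_of_nullCone` (brings ★ V4)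
import Summits.HodgeConjecture.HodgeConjecture.Theorems.K2LiuNullConeSupport          -- ★ V2b `apply_eq_zero_of_eqOn_nullCone` (K2Liu-p11)
import Summits.HodgeConjecture.HodgeConjecture.Theorems.K2LiuTDRestrictionOnto        -- ★ V2c `exists_extension_eventually_eq_zero_pi` (K2Liu-p11)
import Literature.RepresentationTheory.HeisenbergGroup.SchrodingerSymplecticGenerators -- ★ `leviEquivSB`, `coe_leviEquivSB`, `leviOp_apply`
import Literature.NumberTheory.Automorphic.LocalPiSchwartzBruhatFourier               -- ★ `piPrimePowBall`, `isCompact_∕isOpen_∕zero_mem_piPrimePowBall`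
import Mathlib.GroupTheory.NoncommCoprod
import HarnessLib

/-!
# Crux `HLiu418`, road `K2_Liu`, organ A7-val, file V8c: THE (A4″-KR) ASSEMBLY — `ℳ_{K₀}(f^Δ_Φ)(h) = c_v · f^{Δ,S}_{r Φ}(h)` ON `K′`-INVARIANTS, `c_v ≠ 0`

Cell `hodgecm-mathlib`, crux item hLiu418 = `stmt-HodgeConjecture-24832`; squad K2 ∕ K2Liu; prover K2Liu-p09 (g6), organ lead A7-val.  THEOREMS ONLY; lane
`--supports stmt-HodgeConjecture-24832` (count-neutral helper).  RANK- and MODEL-GENERIC master theorem of road (σ) «null-cone multiplicity one»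
(memo `REPORT-FIRST-A7val-PaperFirst.K2Liu-p09-g6.md` §3 V8): the Weil-type action `ω` of `H_v` on `𝒮(X)` (`X = F_v^ι`), the section map `𝒜`, the small
functional `B`, the `U(V′_v)`-action `ρ`, the Levi data `(mΔ, aX, cM)`, the unipotent data `(nΔ, q, ψ)` and the `K′`-average `B̄` enter ONLY through their laws
(binders; payers: ★ β-1∕β-2, ★ A2c∕A2d, ★ (A4-avg), (L2) K2Liu-p10, V6 K2Liu-p11, V3∕V5-inst, V7), so that the CM instance file is a one-screen specialisation.
* `value_eq_const_mul_of_laws` — THE MASTER THEOREM: under the laws, there is `cv ≠ 0` with `ℳ (𝒜 Φ) h = cv · B Φ h` for every `K′`-invariant `Φ` and every `h`.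
  MECHANISM: `T_ℳ := ev₁ ∘ ℳ ∘ 𝒜` and `T_{B̄} := ev₁ ∘ B̄` are linear functionals on `𝒮(X)` which (i) are invariant under `ρ(G)` (★ (A4-avg) ∕ V6), (ii) transform
  under the Levi operators by the SAME character `a ↦ cM(a)⁻¹ χ′_{−½}(mΔ a)` (📤 V8b), (iii) are invariant under the `N_Δ`-modulations, hence kill every test
  function vanishing on the null cone `{q = 0}` (★ V2b); multiplicity one on the cone (★ V5: one `Γ₁ × G`-orbit off the vertex, ★ V2c extension, the vertex
  carries the wrong character) gives `T_{B̄} = c₀ T_ℳ`, `c₀ ≠ 0` by the two witnesses (V7, V6 (iv)); `H_v`-equivariance of both sides upgrades `h = 1` to all `h`.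
HONEST LABEL.  `HC_CM` is proved only modulo the 7 printed citations (2 remaining named inputs: hLiu418 = `stmt-HodgeConjecture-24832`,
h413 = `stmt-HodgeConjecture-24833`) until rung 0 closes.

## References
* [KudlaSweet1997] S. Kudla, W. J. Sweet, Israel J. Math. 98 (1997), §1, Thm. 1.2 (the value of `M*(s)` on `R_n(V)` is the complementary `R_n`).
* [GanQiuTakeda2014] W. T. Gan, Y. Qiu, S. Takeda, Invent. Math. 198 (2014), §2.7–2.8, §5.5 Prop. 11.
* [KudlaRallis1994] S. Kudla, S. Rallis, Annals of Math. 140 (1994), §1; [BernsteinZelevinsky1976] §1.5 (distributions on the null cone).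
-/

set_option autoImplicit false
set_option linter.dupNamespace false -- the mandated namespace repeats `HodgeConjecture.HodgeConjecture`

noncomputable section

open scoped Classical NNReal ENNReal
open NumberField IsDedekindDomain MeasureTheory Topology
open Literature.NumberTheory.GaloisRepresentations Literature.NumberTheory.GaloisRepresentations.IsNonarchimedeanLocalField
open Literature.NumberTheory.Automorphic Literature.NumberTheory.Automorphic.UnitaryGroup
open Literature.NumberTheory.GelbartRogawski1991.UnitaryDualPair.LocalSplitting
open Literature.NumberTheory.K2Lit.LocalSiegelDoubled
open Literature.RepresentationTheory.HeisenbergGroup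
open Summit.HodgeConjecture.HodgeConjecture.Cruxes.HLiu418.K2LiuQRationalDefs
open Summit.HodgeConjecture.HodgeConjecture.Cruxes.HLiu418.K2LiuLocalLFactorDefs
open Summit.HodgeConjecture.HodgeConjecture.Cruxes.HLiu418.K2LiuLocalSiegel
open Summit.HodgeConjecture.HodgeConjecture.Cruxes.HLiu418.K2LiuLocalIntertwiningProperty
open Summit.HodgeConjecture.HodgeConjecture.Cruxes.HLiu418.K2LiuA7ValueMap
open Summit.HodgeConjecture.HodgeConjecture.Cruxes.HLiu418.K2LiuA7ValueLaws
open Summit.HodgeConjecture.HodgeConjecture.Cruxes.HLiu418.K2LiuNullConeMultiplicityOne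
open Summit.HodgeConjecture.HodgeConjecture.Cruxes.HLiu418.K2LiuNullConeSupport
open Summit.HodgeConjecture.HodgeConjecture.Cruxes.HLiu418.K2LiuTDRestrictionOnto

namespace Summit.HodgeConjecture.HodgeConjecture.Cruxes.HLiu418.K2LiuA7Value

variable (F : Type) [Field F] [NumberField F] (E : Type) [Field E] [NumberField E] [Algebra F E]
  [Algebra.IsQuadraticExtension F E] (c : E ≃ₐ[F] E)
  {δ : E} (hcδ : c δ = -δ) (hδ : δ ≠ 0) {d : F} (hd : δ * δ = algebraMap F E d) (v : HeightOneSpectrum (𝓞 F)) (n : ℕ)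
  {T₀ : Matrix (Fin n) (Fin n) F} (hT₀ : T₀.IsSymm) {JD : Matrix (Fin (n + n)) (Fin (n + n)) E} (hJD : JD = (gramD F n T₀).map (algebraMap F E))
  (χv : ∀ w : PlacesOver E v, (w.1.adicCompletion E)ˣ →* ℂˣ) (χv' : ∀ w : PlacesOver E v, (w.1.adicCompletion E)ˣ →* ℂˣ)

/-! ## §1 Two algebraic letters -/

section Letters

variable {K : Type} [Field K] {X : Type} [AddCommGroup X] [Module K X]

omit [NumberField F] [NumberField E] [Algebra.IsQuadraticExtension F E] in
/-- `(f⁻¹).symm = f` in `GL(X)` (the inverse of the automorphism group is `symm`). [folklore] -/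
theorem inv_symm_apply (f : X ≃ₗ[K] X) (z : X) : (f⁻¹).symm z = f z := rfl

omit [NumberField F] [NumberField E] [Algebra.IsQuadraticExtension F E] in
/-- precomposition with `a g` is `leviOp g⁻¹ ∘ leviOp a⁻¹`: `Φ ((a * g) z) = leviOp g⁻¹ (leviOp a⁻¹ Φ) z`. [cite: Weil1964, n° 13] -/
theorem apply_mul_eq_leviOp (a g : X ≃ₗ[K] X) (Φ : X → ℂ) (z : X) : Φ ((a * g) z) = leviOp g⁻¹ (leviOp a⁻¹ Φ) z := by
  rw [leviOp_apply, leviOp_apply, inv_symm_apply, inv_symm_apply, LinearEquiv.mul_apply]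

end Letters

/-! ## §2 The master theorem -/

section Master

variable [MeasurableSpace (unipDeltaLocal F E c v n (JD := JD))] [BorelSpace (unipDeltaLocal F E c v n (JD := JD))]
  (νN : Measure (unipDeltaLocal F E c v n (JD := JD))) [νN.IsMulLeftInvariant] (vol : ℝ)
  (haN : ∀ s : ℂ, 1 < s.re → aNorm F E c v n χv vol s ≠ 0)
  (K₀ : Subgroup (UnitaryGroup.localPi E c (n + n) JD v))
  (hK₀ : IsCompact (K₀ : Set (UnitaryGroup.localPi E c (n + n) JD v)) ∧ IsOpen (K₀ : Set (UnitaryGroup.localPi E c (n + n) JD v)))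
  (hIw : ∀ x : UnitaryGroup.localPi E c (n + n) JD v, ∃ p, IsSiegelDelta F E c hcδ hδ hd v n hT₀ hJD p ∧ ∃ k ∈ K₀, x = p * k)
  (hA4R : ∀ f' : ℂ → UnitaryGroup.localPi E c (n + n) JD v → ℂ, (∀ s, IsLocalSiegelSection F E c hcδ hδ hd v n hT₀ hJD χv s (f' s)) →
    (∀ s, IsSmooth F E c v n (f' s)) → (∀ s s' : ℂ, ∀ k ∈ K₀, f' s k = f' s' k) →
    ∃ Fn' : ℂ → UnitaryGroup.localPi E c (n + n) JD v → ℂ, (∀ h, IsQRationalRegularAt (residueFieldCard (v.adicCompletion F)) (1 / 2) fun s => Fn' s h) ∧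
      ∀ s : ℂ, 1 < s.re → ∀ h, localIntertwining F E c v n hJD νN (f' s) h = aNorm F E c v n χv vol s * Fn' s h)
  (hintA : ∀ f' : ℂ → UnitaryGroup.localPi E c (n + n) JD v → ℂ, (∀ s, IsLocalSiegelSection F E c hcδ hδ hd v n hT₀ hJD χv s (f' s)) →
    (∀ s, IsSmooth F E c v n (f' s)) → (∀ s s' : ℂ, ∀ k ∈ K₀, f' s k = f' s' k) → ∀ s : ℂ, 1 < s.re → ∀ h,
      Integrable (fun u : unipDeltaLocal F E c v n (JD := JD) => f' s (weylDelta F E c v n hJD * (u : UnitaryGroup.localPi E c (n + n) JD v) * h)) νN)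
  (ℳ : ↥(localDegPS F E c hcδ hδ hd v n hT₀ hJD χv (1 / 2)) →ₗ[ℂ] (UnitaryGroup.localPi E c (n + n) JD v → ℂ))
  (hℳ : ∀ (φ : ↥(localDegPS F E c hcδ hδ hd v n hT₀ hJD χv (1 / 2))) (f Fn : ℂ → UnitaryGroup.localPi E c (n + n) JD v → ℂ),
    (∀ s, IsLocalSiegelSection F E c hcδ hδ hd v n hT₀ hJD χv s (f s)) → (∀ s, IsSmooth F E c v n (f s)) → (∀ s s' : ℂ, ∀ k ∈ K₀, f s k = f s' k) →
    f (1 / 2) = (φ : UnitaryGroup.localPi E c (n + n) JD v → ℂ) →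
    (∀ h, IsQRationalRegularAt (residueFieldCard (v.adicCompletion F)) (1 / 2) fun s => Fn s h) →
    (∀ s : ℂ, 1 < s.re → ∀ h, localIntertwining F E c v n hJD νN (f s) h = aNorm F E c v n χv vol s * Fn s h) →
    ∀ h, ℳ φ h = Fn (1 / 2) h)
  (hmod : ∀ (q' : UnitaryGroup.localPi E c (n + n) JD v) (hq : IsSiegelDelta F E c hcδ hδ hd v n hT₀ hJD q'),
    Measure.map (fun u : unipDeltaLocal F E c v n (JD := JD) =>
      (⟨q' * (u : UnitaryGroup.localPi E c (n + n) JD v) * q'⁻¹, conj_mem_unipDeltaLocal F E c hcδ hδ hd v n hT₀ hJD hq u.2⟩ :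
        unipDeltaLocal F E c v n (JD := JD))) νN =
      ENNReal.ofReal ((absDetDelta F E c v n q' ^ n)⁻¹) • νN)
  (hχ' : ∀ (w w' : PlacesOver E v) (h : c • w.1 = w'.1),
    χv' w = (χv w')⁻¹.comp (Units.map (galAdicCompletionMap (L := E) c h : w.1.adicCompletion E →* w'.1.adicCompletion E)))
  (hT₀d : IsUnit T₀.det)
  -- the Schwartz space of `X = F_v^ιX`, the Weil-type action of `H_v`, the section map, the small functional
  {ιX : Type} [Fintype ιX]
  (ω : UnitaryGroup.localPi E c (n + n) JD v → SchwartzBruhat (ιX → v.adicCompletion F) →ₗ[ℂ] SchwartzBruhat (ιX → v.adicCompletion F))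
  (𝒜 : SchwartzBruhat (ιX → v.adicCompletion F) →ₗ[ℂ] ↥(localDegPS F E c hcδ hδ hd v n hT₀ hJD χv (1 / 2)))
  (h𝒜 : ∀ (u : UnitaryGroup.localPi E c (n + n) JD v) (Φ : SchwartzBruhat (ιX → v.adicCompletion F)) (x : UnitaryGroup.localPi E c (n + n) JD v),
    ((𝒜 (ω u Φ) : ↥(localDegPS F E c hcδ hδ hd v n hT₀ hJD χv (1 / 2))) : UnitaryGroup.localPi E c (n + n) JD v → ℂ) x =
      ((𝒜 Φ : ↥(localDegPS F E c hcδ hδ hd v n hT₀ hJD χv (1 / 2))) : UnitaryGroup.localPi E c (n + n) JD v → ℂ) (x * u))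
  (B : SchwartzBruhat (ιX → v.adicCompletion F) →ₗ[ℂ] (UnitaryGroup.localPi E c (n + n) JD v → ℂ))
  (hB : ∀ (u : UnitaryGroup.localPi E c (n + n) JD v) (Φ : SchwartzBruhat (ιX → v.adicCompletion F)) (h : UnitaryGroup.localPi E c (n + n) JD v),
    B (ω u Φ) h = B Φ (h * u))
  (hSiegS : ∀ Φ : SchwartzBruhat (ιX → v.adicCompletion F), IsLocalSiegelSection F E c hcδ hδ hd v n hT₀ hJD χv' (-(1 / 2)) (B Φ))
  -- the partner group `G = U(V′_v)` acting LINEARLY through `ρ`, commuting with `ω(H_v)`, fixing the sections; a compact open `K′ ≤ G`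
  {G : Type} [Group G] [TopologicalSpace G] [IsTopologicalGroup G] [TotallyDisconnectedSpace G] [SigmaCompactSpace G]
  (ρ : G →* ((ιX → v.adicCompletion F) ≃ₗ[v.adicCompletion F] (ιX → v.adicCompletion F)))
  (hρc : ∀ g, Continuous (ρ g)) (hρc' : ∀ g, Continuous (ρ g).symm)
  (h𝒜G : ∀ (g : G) (Φ : SchwartzBruhat (ιX → v.adicCompletion F)) (x : UnitaryGroup.localPi E c (n + n) JD v),
    ((𝒜 (leviEquivSB (ρ g) (hρc g) (hρc' g) Φ) : ↥(localDegPS F E c hcδ hδ hd v n hT₀ hJD χv (1 / 2))) : UnitaryGroup.localPi E c (n + n) JD v → ℂ) x =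
      ((𝒜 Φ : ↥(localDegPS F E c hcδ hδ hd v n hT₀ hJD χv (1 / 2))) : UnitaryGroup.localPi E c (n + n) JD v → ℂ) x)
  (hωG : ∀ (u : UnitaryGroup.localPi E c (n + n) JD v) (g : G) (Φ : SchwartzBruhat (ιX → v.adicCompletion F)),
    ω u (leviEquivSB (ρ g) (hρc g) (hρc' g) Φ) = leviEquivSB (ρ g) (hρc g) (hρc' g) (ω u Φ))
  (K' : Subgroup G) (hK' : IsCompact (K' : Set G) ∧ IsOpen (K' : Set G))
  -- the `K′`-average `B̄` of `B` (V6, K2Liu-p11): a constant on `K′`-invariants, `ρ(G)`-invariant, and transporting every law of `B`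
  (Bbar : SchwartzBruhat (ιX → v.adicCompletion F) →ₗ[ℂ] (UnitaryGroup.localPi E c (n + n) JD v → ℂ)) {cK : ℂ} (hcK : cK ≠ 0)
  (hBbar_fix : ∀ Φ : SchwartzBruhat (ιX → v.adicCompletion F),
    (∀ k ∈ K', leviOp (ρ k) (Φ : (ιX → v.adicCompletion F) → ℂ) = Φ) → ∀ h, Bbar Φ h = cK * B Φ h)
  (hBbar_G : ∀ (g : G) (Φ : SchwartzBruhat (ιX → v.adicCompletion F)) (h : UnitaryGroup.localPi E c (n + n) JD v),
    Bbar (leviEquivSB (ρ g) (hρc g) (hρc' g) Φ) h = Bbar Φ h)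
  (hBbar_law : ∀ A : SchwartzBruhat (ιX → v.adicCompletion F) →ₗ[ℂ] SchwartzBruhat (ιX → v.adicCompletion F),
    (∀ k ∈ K', ∀ Φ, A (leviEquivSB (ρ k) (hρc k) (hρc' k) Φ) = leviEquivSB (ρ k) (hρc k) (hρc' k) (A Φ)) →
    ∀ (h h' : UnitaryGroup.localPi E c (n + n) JD v) (a : ℂ), (∀ Ψ, B (A Ψ) h = a * B Ψ h') → ∀ Φ, Bbar (A Φ) h = a * Bbar Φ h')
  -- the Levi data: `Γ₁ → P_Δ` acting on `X` through `aX` with `ω(mΔ a) = cM a • leviEquivSB (aX a)` (★ A2c∕A2d pin), commuting with `ρ(G)`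
  {Γ₁ : Type} [Group Γ₁] [TopologicalSpace Γ₁] [IsTopologicalGroup Γ₁] [TotallyDisconnectedSpace Γ₁] [SigmaCompactSpace Γ₁]
  (mΔ : Γ₁ →* UnitaryGroup.localPi E c (n + n) JD v) (hmΔ : ∀ a, IsSiegelDelta F E c hcδ hδ hd v n hT₀ hJD (mΔ a))
  (aX : Γ₁ →* ((ιX → v.adicCompletion F) ≃ₗ[v.adicCompletion F] (ιX → v.adicCompletion F)))
  (haXc : ∀ a, Continuous (aX a)) (haXc' : ∀ a, Continuous (aX a).symm)
  (cM : Γ₁ →* ℂˣ)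
  (hM : ∀ (a : Γ₁) (Φ : SchwartzBruhat (ιX → v.adicCompletion F)), ω (mΔ a) Φ = (cM a : ℂ) • leviEquivSB (aX a) (haXc a) (haXc' a) Φ)
  (haXρ : ∀ (a : Γ₁) (g : G), Commute (aX a) (ρ g))
  (hcont : Continuous fun p : (Γ₁ × G) × (ιX → v.adicCompletion F) => aX p.1.1 (ρ p.1.2 p.2))
  (K₁ : Subgroup Γ₁) (hK₁ : IsCompact (K₁ : Set Γ₁) ∧ IsOpen (K₁ : Set Γ₁))
  (hK₁χ : ∀ a ∈ K₁, (cM a : ℂ) = localSiegelCharacter F E c v n χv' (-(1 / 2)) (mΔ a))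
  (a₀ : Γ₁) (ha₀ : (cM a₀ : ℂ) ≠ localSiegelCharacter F E c v n χv' (-(1 / 2)) (mΔ a₀))
  -- the unipotent data: `N_Δ` acts by the modulations `ψ(η ⬝ q(x))` along a continuous `q` (★ A2d pin); the null cone `{q = 0}` is stable and ONE orbit off `0`
  {ι : Type} [Fintype ι] (nΔ : (ι → v.adicCompletion F) → UnitaryGroup.localPi E c (n + n) JD v)
  (hnΔ : ∀ η, nΔ η ∈ unipDeltaLocal F E c v n (JD := JD)) (q : (ιX → v.adicCompletion F) → ι → v.adicCompletion F) (hq : Continuous q)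
  (ψ : AddChar (v.adicCompletion F) Circle) {m : ℤ} (hm : ψ.HasConductorExp m)
  (hN : ∀ (η : ι → v.adicCompletion F) (Φ : SchwartzBruhat (ιX → v.adicCompletion F)) (x : ιX → v.adicCompletion F),
    ((ω (nΔ η) Φ : SchwartzBruhat (ιX → v.adicCompletion F)) : (ιX → v.adicCompletion F) → ℂ) x =
      ((ψ (η ⬝ᵥ q x) : Circle) : ℂ) * (Φ : (ιX → v.adicCompletion F) → ℂ) x)
  (hNρ : ∀ (g : G) (x : ιX → v.adicCompletion F), q x = 0 → q (ρ g x) = 0)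
  (hNa : ∀ (a : Γ₁) (x : ιX → v.adicCompletion F), q x = 0 → q (aX a x) = 0)
  (htrans : ∀ x y : ιX → v.adicCompletion F, q x = 0 → q y = 0 → x ≠ 0 → y ≠ 0 → ∃ (a : Γ₁) (g : G), aX a (ρ g x) = y)
  -- the two witnesses: V7 (`ℳ ∘ 𝒜 ≠ 0`) and V6 (iv) (`B ≠ 0` on some `K′`-invariant datum)
  (hne : ∃ Φ₀ : SchwartzBruhat (ιX → v.adicCompletion F), ℳ (𝒜 Φ₀) 1 ≠ 0)
  (hBne : ∃ Φ₁ : SchwartzBruhat (ιX → v.adicCompletion F), (∀ k ∈ K', leviOp (ρ k) (Φ₁ : (ιX → v.adicCompletion F) → ℂ) = Φ₁) ∧ B Φ₁ 1 ≠ 0)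

include hcδ hδ hd hT₀ hJD hK₀ hIw hA4R hintA haN hℳ hmod hχ' hT₀d h𝒜 hB hSiegS h𝒜G hωG hK' hcK hBbar_fix hBbar_G hBbar_law hmΔ hM haXρ hcont hK₁ hK₁χ ha₀ hnΔ hq hm
  hN hNρ hNa htrans hne hBne in
set_option maxHeartbeats 400000 in
/-- **THE (A4″-KR) MASTER THEOREM (road (σ), memo §3 V8).**  Under the laws listed in the binders there is `cv ≠ 0` with
**`ℳ_{K₀} (𝒜 Φ) h = cv · B Φ h`** for every `K′`-invariant `Φ ∈ 𝒮(X)` and every `h ∈ H_v` — at the instance: the value at `½` of the normalised intertwining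
operator on the Siegel–Weil section of `Φ` is a non-zero constant times the small Siegel–Weil section of the Kudla–Rallis image `r Φ`.  Null-cone multiplicity one
(★ V5 on the descent of ★ V2b∕V2c) applied to `T_ℳ = ev₁ ∘ ℳ ∘ 𝒜` and `T_{B̄} = ev₁ ∘ B̄`, whose laws agree by 📤 V8b; `c₀ ≠ 0` by the witnesses; `H_v`-equivariance
upgrades `h = 1` to every `h`. [cite: KudlaSweet1997, §1, Thm. 1.2] [cite: GanQiuTakeda2014, §2.7–2.8, §5.5 Prop. 11] [cite: KudlaRallis1994, §1] -/
theorem value_eq_const_mul_of_laws :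
    ∃ cv : ℂ, cv ≠ 0 ∧ ∀ Φ : SchwartzBruhat (ιX → v.adicCompletion F),
      (∀ k ∈ K', leviOp (ρ k) (Φ : (ιX → v.adicCompletion F) → ℂ) = Φ) →
      ∀ h : UnitaryGroup.localPi E c (n + n) JD v, ℳ (𝒜 Φ) h = cv * B Φ h := by
  -- the character `χ₁(a) = cM(a)⁻¹ χ′_{−½}(mΔ a)` of the Levi law, and its values
  have hlsc_mul : ∀ a b : Γ₁, localSiegelCharacter F E c v n χv' (-(1 / 2)) (mΔ (a * b)) =
      localSiegelCharacter F E c v n χv' (-(1 / 2)) (mΔ a) * localSiegelCharacter F E c v n χv' (-(1 / 2)) (mΔ b) := fun a b => by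
    rw [map_mul]; exact localSiegelCharacter_mul F E c hcδ hδ hd v n hT₀ hJD χv' _ _ _ (hmΔ a) (hmΔ b)
  have hlsc_ne : ∀ a : Γ₁, localSiegelCharacter F E c v n χv' (-(1 / 2)) (mΔ a) ≠ 0 := fun a h0 => by
    have h1 := hlsc_mul a a⁻¹
    rw [mul_inv_cancel, map_one, h0, zero_mul] at h1
    have h2 := hlsc_mul 1 1
    rw [mul_one, map_one] at h2
    -- `χ(1) = χ(1)²` and `χ(1) = 0` would contradict `χ(a) χ(a⁻¹) = χ(1)`... derive `χ(1) = 0` then `χ(b) = χ(b·1) = 0` for the witness `a₀`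
    have h3 : ∀ b : Γ₁, localSiegelCharacter F E c v n χv' (-(1 / 2)) (mΔ b) = 0 := fun b => by
      have := hlsc_mul b 1
      rw [mul_one, map_one, h1, mul_zero] at this
      exact this
    exact ha₀ (by
      have hK := hK₁χ 1 K₁.one_mem
      rw [map_one, Units.val_one, map_one, h1] at hK
      exact absurd hK one_ne_zero)
  let χ₁ : Γ₁ →* ℂ :=
    { toFun := fun a => ((cM a : ℂ))⁻¹ * localSiegelCharacter F E c v n χv' (-(1 / 2)) (mΔ a)
      map_one' := by
        have h2 := hlsc_mul 1 1
        rw [mul_one] at h2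
        have h1 : localSiegelCharacter F E c v n χv' (-(1 / 2)) (mΔ 1) = 1 := by
          have hne1 := hlsc_ne 1
          exact mul_left_cancel₀ hne1 (by rw [← h2, mul_one])
        rw [map_one, Units.val_one, inv_one, one_mul, h1]
      map_mul' := fun a b => by
        rw [map_mul, Units.val_mul, mul_inv, hlsc_mul]; ring }
  have hχ₁ : ∀ a, χ₁ a = ((cM a : ℂ))⁻¹ * localSiegelCharacter F E c v n χv' (-(1 / 2)) (mΔ a) := fun _ => rfl
  -- the group `Γ = Γ₁ × G`, its linear action on `X`, the character `χ(a, g) = χ₁(a⁻¹)`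
  let πX : Γ₁ × G →* ((ιX → v.adicCompletion F) ≃ₗ[v.adicCompletion F] (ιX → v.adicCompletion F)) := MonoidHom.noncommCoprod aX ρ haXρ
  have hπX : ∀ γ : Γ₁ × G, πX γ = aX γ.1 * ρ γ.2 := fun γ => MonoidHom.noncommCoprod_apply _ _ _ γ
  letI : MulAction (Γ₁ × G) (ιX → v.adicCompletion F) := MulAction.compHom (ιX → v.adicCompletion F) πX
  have hsmul : ∀ (γ : Γ₁ × G) (x : ιX → v.adicCompletion F), γ • x = aX γ.1 (ρ γ.2 x) := fun γ x => by
    show (πX γ) x = _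
    rw [hπX, LinearEquiv.mul_apply]
  haveI : ContinuousSMul (Γ₁ × G) (ιX → v.adicCompletion F) := ⟨by
    have h : (fun p : (Γ₁ × G) × (ιX → v.adicCompletion F) => p.1 • p.2) = fun p => aX p.1.1 (ρ p.1.2 p.2) := funext fun p => hsmul p.1 p.2
    rw [h]; exact hcont⟩
  let χ : Γ₁ × G →* ℂ :=
    { toFun := fun γ => χ₁ γ.1⁻¹
      map_one' := by rw [Prod.fst_one, inv_one, map_one]
      map_mul' := fun a b => by rw [Prod.fst_mul, mul_inv_rev, map_mul, mul_comm] }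
  have hχ : ∀ γ : Γ₁ × G, χ γ = χ₁ γ.1⁻¹ := fun _ => rfl
  -- the two functionals on `𝒮(X)` and their extensions to all functions
  let T₁' : SchwartzBruhat (ιX → v.adicCompletion F) →ₗ[ℂ] ℂ := (LinearMap.proj (1 : UnitaryGroup.localPi E c (n + n) JD v)).comp (ℳ.comp 𝒜)
  let T₂' : SchwartzBruhat (ιX → v.adicCompletion F) →ₗ[ℂ] ℂ := (LinearMap.proj (1 : UnitaryGroup.localPi E c (n + n) JD v)).comp Bbar
  have hT₁' : ∀ Φ, T₁' Φ = ℳ (𝒜 Φ) 1 := fun _ => rfl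
  have hT₂' : ∀ Φ, T₂' Φ = Bbar Φ 1 := fun _ => rfl
  obtain ⟨T₁, hT₁⟩ := LinearMap.exists_extend T₁'
  obtain ⟨T₂, hT₂⟩ := LinearMap.exists_extend T₂'
  have hT₁e : ∀ Φ : SchwartzBruhat (ιX → v.adicCompletion F), T₁ (Φ : (ιX → v.adicCompletion F) → ℂ) = ℳ (𝒜 Φ) 1 := fun Φ => by rw [← hT₁' Φ, ← hT₁]; rfl
  have hT₂e : ∀ Φ : SchwartzBruhat (ιX → v.adicCompletion F), T₂ (Φ : (ιX → v.adicCompletion F) → ℂ) = Bbar Φ 1 := fun Φ => by rw [← hT₂' Φ, ← hT₂]; rfl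
  -- LAWS (i)+(ii): semi-invariance under `Γ` with the character `χ`
  have hlevi : ∀ (Φ : SchwartzBruhat (ιX → v.adicCompletion F)) (γ : Γ₁ × G), (fun z => (Φ : (ιX → v.adicCompletion F) → ℂ) (γ • z)) =
      ((leviEquivSB (ρ γ.2⁻¹) (hρc _) (hρc' _) (leviEquivSB (aX γ.1⁻¹) (haXc _) (haXc' _) Φ) : SchwartzBruhat (ιX → v.adicCompletion F)) :
        (ιX → v.adicCompletion F) → ℂ) := fun Φ γ => by
    funext z
    rw [hsmul, coe_leviEquivSB, coe_leviEquivSB, map_inv, map_inv]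
    exact apply_mul_eq_leviOp (aX γ.1) (ρ γ.2) _ z
  have hsemi₁ : ∀ (Φ : SchwartzBruhat (ιX → v.adicCompletion F)) (γ : Γ₁ × G),
      T₁ (fun z => (Φ : (ιX → v.adicCompletion F) → ℂ) (γ • z)) = χ γ * T₁ (Φ : (ιX → v.adicCompletion F) → ℂ) := fun Φ γ => by
    have hG := valueMap_sectionMap_of_invariant F E c hcδ hδ hd v n hT₀ hJD χv ℳ 𝒜 (leviEquivSB (ρ γ.2⁻¹) (hρc _) (hρc' _)).toLinearMap (h𝒜G γ.2⁻¹)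
      (leviEquivSB (aX γ.1⁻¹) (haXc _) (haXc' _) Φ)
    rw [LinearEquiv.coe_coe] at hG
    have hLv := valueMap_sectionMap_levi F E c hcδ hδ hd v n hT₀ hJD χv χv' ω νN vol haN K₀ hK₀ hIw hA4R hintA ℳ hℳ 𝒜 h𝒜 hmod hχ' hT₀d (hmΔ γ.1⁻¹)
        ((leviEquivSB (aX γ.1⁻¹) (haXc _) (haXc' _)).toLinearMap) (Units.ne_zero (cM γ.1⁻¹)) (fun Ψ => hM γ.1⁻¹ Ψ) Φ
    rw [LinearEquiv.coe_coe] at hLv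
    rw [hlevi, hT₁e, hT₁e, hχ, hχ₁, hG, hLv]
  have hsemi₂ : ∀ (Φ : SchwartzBruhat (ιX → v.adicCompletion F)) (γ : Γ₁ × G),
      T₂ (fun z => (Φ : (ιX → v.adicCompletion F) → ℂ) (γ • z)) = χ γ * T₂ (Φ : (ιX → v.adicCompletion F) → ℂ) := fun Φ γ => by
    rw [hlevi, hT₂e, hT₂e, hχ, hχ₁, hBbar_G]
    have hcommA : ∀ k ∈ K', ∀ Ψ : SchwartzBruhat (ιX → v.adicCompletion F), (leviEquivSB (aX γ.1⁻¹) (haXc _) (haXc' _)).toLinearMap (leviEquivSB (ρ k) (hρc k) (hρc' k) Ψ) =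
        leviEquivSB (ρ k) (hρc k) (hρc' k) ((leviEquivSB (aX γ.1⁻¹) (haXc _) (haXc' _)).toLinearMap Ψ) := fun k _ Ψ => by
      apply Subtype.ext
      simp only [LinearEquiv.coe_coe, coe_leviEquivSB]
      rw [← LinearEquiv.mul_apply, ← leviOp_mul, (haXρ γ.1⁻¹ k).eq, leviOp_mul, LinearEquiv.mul_apply]
    rw [show leviEquivSB (aX γ.1⁻¹) (haXc _) (haXc' _) Φ = (leviEquivSB (aX γ.1⁻¹) (haXc _) (haXc' _)).toLinearMap Φ from rfl,
      hBbar_law _ hcommA 1 1 _ (smallSection_levi F E c hcδ hδ hd v n hT₀ hJD χv' ω B hB hSiegS (hmΔ γ.1⁻¹)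
        ((leviEquivSB (aX γ.1⁻¹) (haXc _) (haXc' _)).toLinearMap) (Units.ne_zero (cM γ.1⁻¹)) (fun Ψ => hM γ.1⁻¹ Ψ)) Φ]
  -- LAW (iii): both functionals factor through the null cone (modulation invariance, ★ V2b)
  have hmodinv₁ : ∀ (η : ι → v.adicCompletion F) (Φ : SchwartzBruhat (ιX → v.adicCompletion F)), T₁' (ω (nΔ η) Φ) = T₁' Φ := fun η Φ => by
    rw [hT₁', hT₁']
    exact valueMap_sectionMap_unip F E c hcδ hδ hd v n hT₀ hJD χv χv' ω νN vol haN K₀ hK₀ hIw hA4R hintA ℳ hℳ 𝒜 h𝒜 hmod hχ' hT₀d ⟨nΔ η, hnΔ η⟩ Φ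
  have hmodinv₂ : ∀ (η : ι → v.adicCompletion F) (Φ : SchwartzBruhat (ιX → v.adicCompletion F)), T₂' (ω (nΔ η) Φ) = T₂' Φ := fun η Φ => by
    rw [hT₂', hT₂']
    have h1 := hBbar_law (ω (nΔ η)) (fun k _ Ψ => hωG (nΔ η) k Ψ) 1 1 1
      (fun Ψ => by rw [one_mul]; exact smallSection_unip F E c hcδ hδ hd v n hT₀ hJD χv' ω B hB hSiegS ⟨nΔ η, hnΔ η⟩ Ψ) Φ
    rw [h1, one_mul]
  have hnull : ∀ (T' : SchwartzBruhat (ιX → v.adicCompletion F) →ₗ[ℂ] ℂ) (T : ((ιX → v.adicCompletion F) → ℂ) →ₗ[ℂ] ℂ),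
      (∀ Φ : SchwartzBruhat (ιX → v.adicCompletion F), T (Φ : (ιX → v.adicCompletion F) → ℂ) = T' Φ) →
      (∀ η Φ, T' (ω (nΔ η) Φ) = T' Φ) →
      ∀ Fx : (ιX → v.adicCompletion F) → ℂ, IsLocallyConstant Fx → HasCompactSupport Fx →
        (∀ x ∈ {x : ιX → v.adicCompletion F | q x = 0}, Fx x = 0) → T Fx = 0 := by
    intro T' T hTT hinv Fx hl hc hvan
    rw [show Fx = ((⟨Fx, ⟨hl, hc⟩⟩ : SchwartzBruhat (ιX → v.adicCompletion F)) : (ιX → v.adicCompletion F) → ℂ) from rfl, hTT]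
    exact apply_eq_zero_of_eqOn_nullCone hm hq (SchwartzBruhat (ιX → v.adicCompletion F)).subtype (SchwartzBruhat (ιX → v.adicCompletion F)).injective_subtype
      (fun η => ω (nΔ η)) (fun η Φ x => hN η Φ x) T' hinv ⟨Fx, ⟨hl, hc⟩⟩ hl hc fun x hx => hvan x hx
  -- MULTIPLICITY ONE (★ V5)
  obtain ⟨Φ₀, hΦ₀⟩ := hne
  obtain ⟨c₀, hc₀⟩ := exists_forall_apply_eq_const_mul_of_nullCone (X := ιX → v.adicCompletion F) (K₁.prod K')
    ((hK₁.2.prod hK'.2)) (hK₁.1.prod hK'.1) χ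
    (fun k hk => by
      rw [hχ, hχ₁, hK₁χ _ (K₁.inv_mem (Subgroup.mem_prod.1 hk).1), inv_mul_cancel₀ (hlsc_ne _)])
    (a₀⁻¹, 1) (by
      rw [hχ, hχ₁, inv_inv]
      intro h1
      exact ha₀ ((inv_mul_eq_one₀ (Units.ne_zero (cM a₀))).1 h1))
    (0 : ιX → v.adicCompletion F) (fun γ => by rw [hsmul, map_zero, map_zero])
    ⟨piPrimePowBall (v.adicCompletion F) ιX 0, ⟨(isCompact_piPrimePowBall 0).isClosed, isOpen_piPrimePowBall 0⟩,
      isCompact_piPrimePowBall 0, zero_mem_piPrimePowBall 0⟩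
    {x : ιX → v.adicCompletion F | q x = 0} (isClosed_eq hq continuous_const)
    (fun γ x hx => by
      rw [hsmul]
      exact hNa γ.1 _ (hNρ γ.2 x hx))
    (fun x hx y hy hx0 hy0 => by
      obtain ⟨a, g, hag⟩ := htrans x y hx hy hx0 hy0
      exact ⟨(a, g), by rw [hsmul]; exact hag⟩)
    (fun f hfl hfc => exists_extension_eventually_eq_zero_pi (0 : ιX → v.adicCompletion F) f hfl hfc)
    T₁ T₂
    (fun Fx hl hc γ => by
      exact hsemi₁ ⟨Fx, ⟨hl, hc⟩⟩ γ)
    (fun Fx hl hc γ => by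
      exact hsemi₂ ⟨Fx, ⟨hl, hc⟩⟩ γ)
    (hnull T₁' T₁ hT₁e hmodinv₁) (hnull T₂' T₂ hT₂e hmodinv₂)
    Φ₀.2.1 Φ₀.2.2 (by rw [hT₁e]; exact hΦ₀)
  -- `T₂' = c₀ T₁'` on `𝒮(X)`; `c₀ ≠ 0` by the `B`-witness
  have hprop : ∀ Φ : SchwartzBruhat (ιX → v.adicCompletion F), Bbar Φ 1 = c₀ * ℳ (𝒜 Φ) 1 := fun Φ => by
    rw [← hT₁e, ← hT₂e]; exact hc₀ _ Φ.2.1 Φ.2.2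
  obtain ⟨Φ₁, hΦ₁K, hΦ₁⟩ := hBne
  have hc₀ne : c₀ ≠ 0 := by
    intro h0
    have h1 := hprop Φ₁
    rw [h0, zero_mul, hBbar_fix Φ₁ hΦ₁K 1] at h1
    exact (mul_ne_zero hcK hΦ₁) h1
  -- the identity on `K′`-invariants, for every `h`
  refine ⟨c₀⁻¹ * cK, mul_ne_zero (inv_ne_zero hc₀ne) hcK, fun Φ hΦK h => ?_⟩
  have hfixΦ : ∀ k ∈ K', leviEquivSB (ρ k) (hρc k) (hρc' k) Φ = Φ := fun k hk => Subtype.ext (by rw [coe_leviEquivSB]; exact hΦK k hk)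
  have hωΦK : ∀ k ∈ K', leviOp (ρ k) ((ω h Φ : SchwartzBruhat (ιX → v.adicCompletion F)) : (ιX → v.adicCompletion F) → ℂ) = ω h Φ := fun k hk => by
    rw [← coe_leviEquivSB (ρ k) (hρc k) (hρc' k), ← hωG h k Φ, hfixΦ k hk]
  have h1 : ℳ (𝒜 Φ) h = ℳ (𝒜 (ω h Φ)) 1 :=
    valueMap_sectionMap_apply F E c hcδ hδ hd v n hT₀ hJD χv ω νN vol haN K₀ hK₀ hIw hA4R hintA ℳ hℳ 𝒜 h𝒜 h Φ
  have h2 : Bbar (ω h Φ) 1 = cK * B Φ h := by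
    rw [hBbar_fix (ω h Φ) hωΦK 1, hB h Φ 1, one_mul]
  have h3 := hprop (ω h Φ)
  rw [h2] at h3
  rw [h1, mul_assoc, h3, ← mul_assoc, inv_mul_cancel₀ hc₀ne, one_mul]

end Master

end Summit.HodgeConjecture.HodgeConjecture.Cruxes.HLiu418.K2LiuA7Value

end
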